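import Mathlib
import HarnessLib
import Summits.NavierStokesRegularity.NavierStokesRegularity.Theorems.UnthreadedDoorNetFluxCurledLawRadialGauge
import Summits.NavierStokesRegularity.NavierStokesRegularity.Theorems.AxisTwistDoorAveragedConeLiouvillePositivityCylinders

/-!
# Route `UnthreadedDoor`, crux `PoloidalLiouville` (stmt-NavierStokesRegularity-1222), WALL W1 — crux idea «kinematic-shadow» (ns-idea-15,
# `Cruxes/PoloidalLiouville/KinematicShadowSketch.lean` v1.2): ZONAL BRICKS — coordinate-free calculus for the zonal sub-rung A_z `HomogeneousZonalToroidalNeverSteady` (ARM A g5 holds A_z by name, two stages; this file is imported by / complementary to its Stage 1)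

KEY-NS #185/#186.  The potential of A_z is `T(x) = t(c(x))`, `c(x) = ⟪x − x₀, e⟫/‖x − x₀‖` (the axis cosine).  This file lands the
coordinate-free calculus facts every proof of A_z starts from (prover note `pub/ideators/ns-qj-p1/NOTE-kinematic-shadow-zonal-pointwise-qj-p1-g5.md`):
* `hasGradientAt_axisCos` — `∇c(x) = ‖x−x₀‖⁻¹ e − ⟪x−x₀,e⟫‖x−x₀‖⁻³ (x − x₀)` off `x₀` (product of `⟪· − x₀, e⟫` and `‖· − x₀‖⁻¹`,
  `NetFlux.hasGradientAt_radialFun`);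
* `hasGradientAt_zonal` — `∇T(x) = t′(c x) · ∇c(x)` (chain rule); `inner_gradient_zonal_self` — `⟪∇T(x), x − x₀⟫ = 0` (Euler: `T` is
  0-homogeneous);
* `laplacian_zonal_eq_of_reflect` — `ΔT` is ZONAL: `ΔT(y) = ΔT(z)` whenever `‖y − x₀‖ = ‖z − x₀‖` and `⟪y − x₀, e⟫ = ⟪z − x₀, e⟫` (the
  reflection in the bisector hyperplane of `y − x₀`, `z − x₀` fixes `e` and `T`; the Laplacian commutes with isometries — no differentiability
  needed, as in `NetFlux.laplacian_radialFun_sphere_const`);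
* `laplacian_zonal_dilate` — `ΔT(x₀ + ρ v) = (ρ²)⁻¹ ΔT(x₀ + v)` for `ρ > 0` (`T` is 0-homogeneous; `laplacian_comp_affine`).
Together: `ΔT(x) = L(θ(x))/‖x − x₀‖²` with `L` a function of the polar angle alone — the input `L` of the landed transport core
`KinematicShadow.transport_noGo` (p689526).  The frame reduction of the steady law to the transport equation is NOT in this file.

HONEST LABEL: calculus bricks for an information-grade no-go statement in the LINEAR kinematic shadow (critic V20: W1 movement 0); A_z itself,
`PoloidalLiouville` (1222), W1 and the summit stay OPEN; NO Navier–Stokes regularity statement is proved.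
`--supports stmt-NavierStokesRegularity-1222 --as helper`.  [folklore]
-/

noncomputable section

-- the summit and its single sub-problem share the name (CONVENTIONS §1)
set_option linter.dupNamespace false

open Set Function Filter Topology InnerProductSpace
open scoped RealInnerProductSpace Laplacian

namespace Summit.NavierStokesRegularity.NavierStokesRegularity.Theorems.PoloidalLiouville.KinematicShadow

open Literature.Analysis Literature.Analysis.FluidPDE
open Summit.NavierStokesRegularity.NavierStokesRegularity.Theorems.PoloidalLiouville.NetFlux (E3 hasGradientAt_radialFun)
open Summit.NavierStokesRegularity.NavierStokesRegularity.Theorems.AveragedConeLiouville.PositivityCylinders (laplacian_comp_affine)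

/-! ### The axis cosine `c(x) = ⟪x − x₀, e⟫ / ‖x − x₀‖` -/

/-- Gradient of the axial coordinate `z ↦ ⟪z − x₀, e⟫` is `e`. [folklore] -/
theorem hasGradientAt_inner_sub_const (x₀ e x : E3) : HasGradientAt (fun z : E3 => ⟪z - x₀, e⟫) e x := by
  rw [hasGradientAt_iff_hasFDerivAt]
  have h : HasFDerivAt (fun z : E3 => (innerSL ℝ e) z - ⟪e, x₀⟫) (innerSL ℝ e) x :=
    (innerSL ℝ e).hasFDerivAt.sub_const _
  have heq : (fun z : E3 => (innerSL ℝ e) z - ⟪e, x₀⟫) = fun z => ⟪z - x₀, e⟫ := by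
    funext z; rw [innerSL_apply_apply, inner_sub_left, real_inner_comm x₀ e, real_inner_comm z e]
  rw [heq] at h
  have hte : (toDual ℝ E3 e : E3 →L[ℝ] ℝ) = innerSL ℝ e := by
    ext v; simp [InnerProductSpace.toDual_apply_apply]
  rw [hte]
  exact h

/-- **Gradient of the axis cosine** off the centre:
`∇c(x) = ⟪x − x₀, e⟫ · ((−(‖x−x₀‖²)⁻¹/‖x−x₀‖) · (x − x₀)) + ‖x − x₀‖⁻¹ · e`. [folklore] -/
theorem hasGradientAt_axisCos (x₀ e : E3) {x : E3} (hx : x ≠ x₀) :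
    HasGradientAt (fun z : E3 => ⟪z - x₀, e⟫ / ‖z - x₀‖)
      (⟪x - x₀, e⟫ • ((-(‖x - x₀‖ ^ 2)⁻¹ / ‖x - x₀‖) • (x - x₀)) + (‖x - x₀‖)⁻¹ • e) x := by
  have hr : 0 < ‖x - x₀‖ := norm_pos_iff.2 (sub_ne_zero.2 hx)
  have h1 := hasGradientAt_inner_sub_const x₀ e x
  have h2 : HasGradientAt (fun z : E3 => (‖z - x₀‖)⁻¹) ((-(‖x - x₀‖ ^ 2)⁻¹ / ‖x - x₀‖) • (x - x₀)) x :=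
    hasGradientAt_radialFun (ρ := fun s : ℝ => s⁻¹) hx (hasDerivAt_inv hr.ne')
  rw [hasGradientAt_iff_hasFDerivAt] at h1 h2 ⊢
  have h := h1.mul h2
  have heq : ((fun z : E3 => ⟪z - x₀, e⟫) * fun z : E3 => (‖z - x₀‖)⁻¹) = fun z => ⟪z - x₀, e⟫ / ‖z - x₀‖ := by
    funext z; simp [div_eq_mul_inv]
  rw [heq] at h
  exact h.congr_fderiv (by simp only [map_add, map_smul])

/-! ### The zonal potential `T = t ∘ c` -/

/-- **Gradient of a zonal 0-homogeneous potential** `T(z) = t(⟪z − x₀, e⟫/‖z − x₀‖)` off the centre: `∇T(x) = t′(c x) · ∇c(x)`. [folklore] -/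
theorem hasGradientAt_zonal (t : ℝ → ℝ) (x₀ e : E3) {x : E3} (hx : x ≠ x₀) {t' : ℝ}
    (ht : HasDerivAt t t' (⟪x - x₀, e⟫ / ‖x - x₀‖)) :
    HasGradientAt (fun z : E3 => t (⟪z - x₀, e⟫ / ‖z - x₀‖))
      (t' • (⟪x - x₀, e⟫ • ((-(‖x - x₀‖ ^ 2)⁻¹ / ‖x - x₀‖) • (x - x₀)) + (‖x - x₀‖)⁻¹ • e)) x := by
  have hc := hasGradientAt_axisCos x₀ e hx
  rw [hasGradientAt_iff_hasFDerivAt] at hc ⊢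
  have h := ht.comp_hasFDerivAt x hc
  exact h.congr_fderiv (by simp only [map_smul])

/-- **Euler's relation for the zonal 0-homogeneous potential**: its gradient is tangential, `⟪∇T(x), x − x₀⟫ = 0`. [folklore] -/
theorem inner_gradient_zonal_self (t : ℝ → ℝ) (x₀ e : E3) {x : E3} (hx : x ≠ x₀)
    (ht : DifferentiableAt ℝ t (⟪x - x₀, e⟫ / ‖x - x₀‖)) :
    ⟪gradient (fun z : E3 => t (⟪z - x₀, e⟫ / ‖z - x₀‖)) x, x - x₀⟫ = 0 := by
  have hr : 0 < ‖x - x₀‖ := norm_pos_iff.2 (sub_ne_zero.2 hx)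
  rw [(hasGradientAt_zonal t x₀ e hx ht.hasDerivAt).gradient]
  rw [inner_smul_left, inner_add_left, inner_smul_left, inner_smul_left, inner_smul_left, real_inner_self_eq_norm_sq,
    real_inner_comm]
  simp only [conj_trivial]
  have hr0 : ‖x - x₀‖ ≠ 0 := hr.ne'
  field_simp
  ring

/-! ### `ΔT` is zonal (reflection) and `(−2)`-homogeneous (dilation) -/

/-- **`ΔT` is zonal**: for `T(z) = t(⟪z − x₀, e⟫/‖z − x₀‖)`, `ΔT(y) = ΔT(z)` whenever `‖y − x₀‖ = ‖z − x₀‖` and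
`⟪y − x₀, e⟫ = ⟪z − x₀, e⟫` — the reflection in the bisector hyperplane of `y − x₀`, `z − x₀` is a linear isometry fixing `e` and `T`, and
the Laplacian commutes with isometries and translations (no differentiability needed). [folklore] -/
theorem laplacian_zonal_eq_of_reflect (t : ℝ → ℝ) (x₀ e : E3) {y z : E3} (hn : ‖y - x₀‖ = ‖z - x₀‖)
    (he : ⟪y - x₀, e⟫ = ⟪z - x₀, e⟫) :
    Δ (fun w : E3 => t (⟪w - x₀, e⟫ / ‖w - x₀‖)) y = Δ (fun w : E3 => t (⟪w - x₀, e⟫ / ‖w - x₀‖)) z := by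
  set ψ : E3 → ℝ := fun u => t (⟪u, e⟫ / ‖u‖) with hψ
  -- translation
  have htr : ∀ w : E3, Δ (fun w : E3 => t (⟪w - x₀, e⟫ / ‖w - x₀‖)) w = Δ ψ (w + -x₀) := by
    intro w
    have e1 : (fun w : E3 => t (⟪w - x₀, e⟫ / ‖w - x₀‖)) = fun w => ψ (w + -x₀) := by
      funext w; simp [hψ, sub_eq_add_neg]
    rw [e1]
    exact laplacian_comp_add_right ψ (-x₀) w
  rw [htr y, htr z]
  -- the reflection swapping `y − x₀` and `z − x₀`; it fixes `e`
  set R : E3 ≃ₗᵢ[ℝ] E3 := Submodule.reflection (ℝ ∙ ((y + -x₀) - (z + -x₀)))ᗮ with hR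
  have hRy : R (y + -x₀) = z + -x₀ := by
    rw [hR]
    exact Submodule.reflection_sub (by rw [← sub_eq_add_neg, ← sub_eq_add_neg]; exact hn)
  have hRe : R e = e := by
    rw [hR]
    apply Submodule.reflection_mem_subspace_eq_self
    rw [Submodule.mem_orthogonal_singleton_iff_inner_right]
    rw [← sub_eq_add_neg, ← sub_eq_add_neg, show y - x₀ - (z - x₀) = (y - x₀) - (z - x₀) by rfl, inner_sub_left, he, sub_self]
  have hRsymm : R.symm (y + -x₀) = z + -x₀ := by
    rw [hR, Submodule.reflection_symm, ← hR]; exact hRy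
  have hinv : (fun u : E3 => ψ (R.symm u)) = ψ := by
    funext u
    have h1 : ⟪R.symm u, e⟫ = ⟪u, e⟫ := by
      conv_rhs => rw [← LinearIsometryEquiv.apply_symm_apply R u, ← hRe]
      rw [LinearIsometryEquiv.inner_map_map]
    simp [hψ, h1]
  have h1 := laplacian_comp_linearIsometryEquiv_symm R ψ (y + -x₀)
  rw [hinv, hRsymm] at h1
  exact h1

/-- **`ΔT` is `(−2)`-homogeneous**: for `T(z) = t(⟪z − x₀, e⟫/‖z − x₀‖)` and `ρ > 0`, `ΔT(x₀ + ρ v) = (ρ²)⁻¹ ΔT(x₀ + v)`. [folklore] -/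
theorem laplacian_zonal_dilate (t : ℝ → ℝ) (x₀ e v : E3) {ρ : ℝ} (hρ : 0 < ρ) :
    Δ (fun w : E3 => t (⟪w - x₀, e⟫ / ‖w - x₀‖)) (x₀ + ρ • v) =
      (ρ ^ 2)⁻¹ • Δ (fun w : E3 => t (⟪w - x₀, e⟫ / ‖w - x₀‖)) (x₀ + v) := by
  set T : E3 → ℝ := fun w => t (⟪w - x₀, e⟫ / ‖w - x₀‖) with hT
  -- `T(x₀ + ρ y) = T(x₀ + y)` for every `y`
  have hhom : (fun y : E3 => T (x₀ + ρ • y)) = fun y => T (x₀ + (1 : ℝ) • y) := by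
    funext y
    simp only [hT, one_smul, add_sub_cancel_left, inner_smul_left, conj_trivial, norm_smul, Real.norm_eq_abs,
      abs_of_pos hρ]
    by_cases hy : y = 0
    · simp [hy]
    · rw [mul_div_mul_left _ _ hρ.ne']
  have h1 := laplacian_comp_affine T x₀ ρ v
  have h2 := laplacian_comp_affine T x₀ 1 v
  rw [hhom] at h1
  rw [one_pow, one_smul, one_smul] at h2
  rw [h2] at h1
  -- `h1 : Δ T (x₀ + v) = ρ ^ 2 • Δ T (x₀ + ρ • v)`
  rw [h1, smul_smul, inv_mul_cancel₀ (pow_ne_zero 2 hρ.ne'), one_smul]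

end Summit.NavierStokesRegularity.NavierStokesRegularity.Theorems.PoloidalLiouville.KinematicShadow

end
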